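import Mathlib.RingTheory.Polynomial.Pochhammer
import Mathlib.Algebra.Polynomial.BigOperators
import Mathlib.Algebra.Polynomial.Eval.SMul
import Mathlib.RingTheory.MvPolynomial.Basic
import Mathlib.Algebra.MvPolynomial.Monad
import Mathlib.Algebra.MvPolynomial.CommRing
import Mathlib.Data.Finset.Powerset
import Mathlib.Data.Nat.Choose.Basic
import Mathlib.Analysis.Complex.Basic
import HarnessLib

/-!
# Minsky–Papert symmetrization (Beals et al., Lemma 3.2)

**The printed statement** (R. Beals, H. Buhrman, R. Cleve, M. Mosca, R. de Wolf, *Quantum lower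
bounds by polynomials*, J. ACM 48 (2001), Lemma 3.2, after Minsky–Papert, *Perceptrons*
(1968)): "If `p : ℝⁿ → ℝ` is a multilinear polynomial, then there exists a polynomial
`q : ℝ → ℝ`, of degree at most the degree of `p`, such that `p^{sym}(X) = q(|X|)` for all
`X ∈ {0,1}^N`", where `p^{sym}(X) = (∑_{π ∈ S_N} p(π(X)))/N!`.

Since `p^{sym}(X)` depends only on `|X|` and equals the average of `p` over the inputs of
Hamming weight `|X|`, we vendor the lemma in the equivalent weight-class form that the proof of
Beals et al. Thm. 4.13 consumes: for `q : MvPolynomial (Fin b) ℝ` there is a univariate real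
polynomial `symPoly b q` of degree `≤ totalDegree q` (`natDegree_symPoly_le`) with
`C(b, i) · (symPoly b q)(i) = ∑_{|S| = i} q(1_S)` for every integer `i`
(`choose_mul_symPoly_eval`), i.e. `(symPoly b q)(i)` is the average of `q` over the Boolean
points of weight `i ≤ b`. Multilinearity is not assumed: on `{0,1}^b` a monomial with support
`M` is the indicator of `M ⊆ S` whatever its exponents (`eval_monomial_indicatorVec`).

**The printed proof** ("`V_j` assumes value `C(|X|, j)` on `X`, which is a polynomial of
degree `j` of `|X|`") becomes: a monomial with support `M`, `|M| = s`, averages over the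
weight-`i` points to `#{S ⊇ M, |S| = i} / C(b,i) = i(i-1)⋯(i-s+1) / (b(b-1)⋯(b-s+1))`
(`card_filter_superset_mul_descFactorial`: `#{S ⊇ M, |S| = i} · b^{(s)} = C(b,i) · i^{(s)}`),
the descending Pochhammer polynomial `descPochhammer ℝ s` of degree `s ≤ deg` evaluated at `i`
and divided by the constant `b^{(s)}`.

Mathlib supplies `descPochhammer`, `descPochhammer_eval_eq_descFactorial`, `Nat.choose_mul`,
`Finset.powersetCard`; it has no symmetrization lemma (searched `symmetriz`, `Minsky`).

## References

* R. Beals, H. Buhrman, R. Cleve, M. Mosca, R. de Wolf, *Quantum lower bounds by polynomials*,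
  J. ACM 48 (2001) 778–797, Lemma 3.2 (arXiv:quant-ph/9802049, p. 5) [BealsEtAl2001].
* M. Minsky, S. Papert, *Perceptrons*, MIT Press 1968 (original source).
-/

namespace Literature.Computability.QuantumComplexity

open MvPolynomial Finset

/-! ### Evaluating monomials at indicator vectors -/

variable {b : ℕ}

/-- The `0/1` indicator vector `1_S ∈ {0,1}^b ⊂ ℝ^b` of a set of coordinates. [folklore] -/
def indicatorVec (S : Finset (Fin b)) : Fin b → ℝ := fun k => if k ∈ S then 1 else 0

/-- On `{0,1}^b` a monomial with support `M` is the indicator of `M ⊆ S`, whatever its (positive)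
exponents. [folklore] -/
theorem eval_monomial_indicatorVec (S : Finset (Fin b)) (m : Fin b →₀ ℕ) (c : ℝ) :
    MvPolynomial.eval (indicatorVec S) (monomial m c) = if m.support ⊆ S then c else 0 := by
  rw [MvPolynomial.eval_monomial, Finsupp.prod]
  by_cases h : m.support ⊆ S
  · rw [if_pos h, Finset.prod_eq_one, mul_one]
    intro k hk
    simp [indicatorVec, h hk]
  · rw [if_neg h]
    obtain ⟨k, hk, hkS⟩ := Finset.not_subset.mp h
    rw [Finset.prod_eq_zero hk, mul_zero]
    have : m k ≠ 0 := Finsupp.mem_support_iff.mp hk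
    simp [indicatorVec, hkS, this]

/-! ### Counting supersets of prescribed size -/

/-- The number of `i`-subsets of `Fin b` containing a fixed `M` is `C(b - |M|, i - |M|)` (for `|M| ≤
i`). [folklore] -/
theorem card_filter_superset (M : Finset (Fin b)) {i : ℕ} (hM : M.card ≤ i) :
    ((Finset.univ.powersetCard i).filter fun S => M ⊆ S).card =
      (b - M.card).choose (i - M.card) := by
  classical
  have hb : (Finset.univ \ M).card = b - M.card := by
    rw [Finset.card_sdiff_of_subset (Finset.subset_univ M), Finset.card_univ, Fintype.card_fin]
  rw [← hb, ← Finset.card_powersetCard]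
  refine Finset.card_bij (fun S _ => S \ M) (fun S hS => ?_) (fun S₁ h₁ S₂ h₂ h => ?_)
    (fun T hT => ?_)
  · simp only [Finset.mem_filter, Finset.mem_powersetCard] at hS
    simp only [Finset.mem_powersetCard]
    refine ⟨Finset.sdiff_subset_sdiff (Finset.subset_univ _) le_rfl, ?_⟩
    rw [Finset.card_sdiff_of_subset hS.2, hS.1.2]
  · simp only [Finset.mem_filter, Finset.mem_powersetCard] at h₁ h₂
    rw [← Finset.sdiff_union_of_subset h₁.2, ← Finset.sdiff_union_of_subset h₂.2, h]
  · simp only [Finset.mem_powersetCard] at hT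
    refine ⟨T ∪ M, ?_, ?_⟩
    · simp only [Finset.mem_filter, Finset.mem_powersetCard]
      have hdisj : Disjoint T M := by
        rw [Finset.disjoint_left]
        intro k hk hkM
        exact (Finset.mem_sdiff.mp (hT.1 hk)).2 hkM
      refine ⟨⟨Finset.subset_univ _, ?_⟩, Finset.subset_union_right⟩
      rw [Finset.card_union_of_disjoint hdisj, hT.2]
      omega
    · rw [Finset.union_sdiff_right, Finset.sdiff_eq_self_iff_disjoint]
      rw [Finset.disjoint_left]
      intro k hkT hkM
      exact (Finset.mem_sdiff.mp (hT.1 hkT)).2 hkM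

/-- `#{S ⊇ M, |S| = i} · b(b-1)⋯(b-s+1) = C(b,i) · i(i-1)⋯(i-s+1)`, `s = |M|` (all cases, including
`s > i` and `i > b`, where both sides vanish). [folklore] -/
theorem card_filter_superset_mul_descFactorial (M : Finset (Fin b)) (i : ℕ) :
    ((Finset.univ.powersetCard i).filter fun S => M ⊆ S).card * b.descFactorial M.card =
      b.choose i * i.descFactorial M.card := by
  classical
  set s := M.card with hs
  have hsb : s ≤ b := by simpa using Finset.card_le_univ M
  rcases le_or_gt s i with hsi | hsi
  · rw [card_filter_superset M hsi]
    rcases le_or_gt i b with hib | hib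
    · rw [Nat.descFactorial_eq_factorial_mul_choose b s,
        Nat.descFactorial_eq_factorial_mul_choose i s]
      have h := Nat.choose_mul (n := b) hsi
      calc (b - s).choose (i - s) * (s.factorial * b.choose s)
          = s.factorial * (b.choose s * (b - s).choose (i - s)) := by ring
        _ = s.factorial * (b.choose i * i.choose s) := by rw [h]
        _ = b.choose i * (s.factorial * i.choose s) := by ring
    · rw [Nat.choose_eq_zero_of_lt hib, zero_mul, Nat.choose_eq_zero_of_lt (by omega), zero_mul]
  · have h0 : ((Finset.univ.powersetCard i).filter fun S => M ⊆ S) = ∅ := by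
      rw [Finset.filter_eq_empty_iff]
      intro S hS hMS
      have := Finset.card_le_card hMS
      rw [(Finset.mem_powersetCard.mp hS).2] at this
      omega
    rw [h0, Finset.card_empty, zero_mul, Nat.descFactorial_eq_zero_iff_lt.mpr hsi, mul_zero]

/-! ### Minsky–Papert symmetrization (Beals et al. Lemma 3.2) -/

/-- The symmetrization of `q` as a univariate polynomial: a monomial with support `M`
(`|M| = s`) becomes `k(k-1)⋯(k-s+1) / (b(b-1)⋯(b-s+1))`, the fraction of `k`-sets containing
`M` (the polynomial `q` of Lemma 3.2, in the weight variable `k = |X|`). [cite: BealsEtAl2001, Lemma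
3.2] -/
noncomputable def symPoly (b : ℕ) (q : MvPolynomial (Fin b) ℝ) : Polynomial ℝ :=
  ∑ m ∈ q.support, (q.coeff m / (b.descFactorial m.support.card : ℝ)) •
    descPochhammer ℝ m.support.card

/-- The support of a monomial has at most `degree` elements. [folklore] -/
theorem card_support_le_degree (m : Fin b →₀ ℕ) : m.support.card ≤ m.sum fun _ e => e := by
  rw [Finsupp.sum, Finset.card_eq_sum_ones]
  exact Finset.sum_le_sum fun k hk => Nat.one_le_iff_ne_zero.mpr (Finsupp.mem_support_iff.mp hk)

/-- `deg (symPoly b q) ≤ deg q` ("of degree at most the degree of `p`"). [cite: BealsEtAl2001, Lemma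
3.2] -/
theorem natDegree_symPoly_le (q : MvPolynomial (Fin b) ℝ) :
    (symPoly b q).natDegree ≤ q.totalDegree := by
  unfold symPoly
  refine Polynomial.natDegree_sum_le_of_forall_le _ _ fun m hm => ?_
  refine (Polynomial.natDegree_smul_le _ _).trans ?_
  rw [descPochhammer_natDegree]
  exact (card_support_le_degree m).trans (MvPolynomial.le_totalDegree hm)

/-- **Minsky–Papert symmetrization** (Beals et al. Lemma 3.2, weight-class form): for every
integer `i`, `C(b, i) · (symPoly b q)(i) = ∑_{|S| = i} q(1_S)`, i.e. for `i ≤ b` the value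
`(symPoly b q)(i)` is the average of `q` over the Boolean points of Hamming weight `i` (for
`i > b` both sides vanish). [cite: BealsEtAl2001, Lemma 3.2] -/
theorem choose_mul_symPoly_eval (q : MvPolynomial (Fin b) ℝ) (i : ℕ) :
    (b.choose i : ℝ) * (symPoly b q).eval (i : ℝ) =
      ∑ S ∈ Finset.univ.powersetCard i, MvPolynomial.eval (indicatorVec S) q := by
  classical
  -- right-hand side, monomial by monomial
  have hR : ∑ S ∈ Finset.univ.powersetCard i, MvPolynomial.eval (indicatorVec S) q =
      ∑ m ∈ q.support, q.coeff m *
        (((Finset.univ.powersetCard i).filter fun S => m.support ⊆ S).card : ℝ) := by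
    conv_lhs => rw [q.as_sum]
    simp only [map_sum, eval_monomial_indicatorVec]
    rw [Finset.sum_comm]
    refine Finset.sum_congr rfl fun m _ => ?_
    rw [Finset.sum_ite, Finset.sum_const_zero, add_zero, Finset.sum_const, nsmul_eq_mul, mul_comm]
  rw [hR, symPoly, Polynomial.eval_finsetSum, Finset.mul_sum]
  refine Finset.sum_congr rfl fun m hm => ?_
  rw [Polynomial.eval_smul, descPochhammer_eval_eq_descFactorial, smul_eq_mul]
  have hs : m.support.card ≤ b := by
    simpa using Finset.card_le_univ m.support
  have hpos : (0 : ℝ) < b.descFactorial m.support.card := by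
    exact_mod_cast Nat.pos_of_ne_zero (fun h => by
      rw [Nat.descFactorial_eq_zero_iff_lt] at h; omega)
  have key := card_filter_superset_mul_descFactorial m.support i
  have key' : (((Finset.univ.powersetCard i).filter fun S => m.support ⊆ S).card : ℝ) *
      b.descFactorial m.support.card = b.choose i * i.descFactorial m.support.card := by
    exact_mod_cast key
  field_simp
  linear_combination (-coeff m q) * key'

end Literature.Computability.QuantumComplexity
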